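import Summits.MatrixMultiplication.MatrixMultiplication.Theorems.LevelGradedCohnUmansLevelOneGL2DesignsParabolaFreeSearchSound
import Summits.MatrixMultiplication.MatrixMultiplication.Theorems.LevelGradedCohnUmansLevelOneGL2DesignsTangencyCertificates

/-!
# Parabola-free sets of `ℤ_p²`: from finite sets of `ZMod p × ZMod p` to bit masks
(stub `stub_tangencySets` of the crux `LevelOneGL2Designs`, stmt-MatrixMultiplication-14080;
wall-breaker axis 5/12, *parabola lifts over finite fields*, family P2-mod)

The reduction half (part 1: masks, adjacency, counting) of the exactness results `α₇ = 10`,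
`α₁₁ = 23`; part 2 (`…ParabolaFreeExact.lean`) has the normal form and the theorem.  For a parabola-free
`T ⊆ ℤ_p × ℤ_p` (`PF T`: no two points differ by `(r, ±r²)`, `r ≠ 0`, in the planner's hypothesis
shape) we (1) translate a largest column through the origin, (2) dilate by
`(x, c) ↦ (u x, η c)`, `η = ±u²` (an automorphism of the parabola graph) so that the column-0 set
becomes numerically minimal in its dilation orbit ("canonical"), (3) pass to column bit masks
(`colMask`) and check the hypotheses of `PFS.topA_false`: adjacency in the packed table is exactly
the parabola relation (`not_adj_of_PF`), the cap is the size of column 0, and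
`|T| = Σₓ |column x|` (`card_eq_sum_cols`).  The generic conclusion `no_parabolaFree` takes the
per-`p` decidable facts (popcount table, neighbourhood table, square roots of `±η`, and the search
verdicts `refuteM p K m = true`) as hypotheses; the instance files discharge them with
`decide +kernel`.
-/

set_option linter.dupNamespace false -- `MatrixMultiplication.MatrixMultiplication` (summit = problem, D-0017)

namespace Summit.MatrixMultiplication.MatrixMultiplication.Theorems.LevelOneGL2Designs.PFS

open Finset

/-! ## Masks of predicates and of columns -/

/-- the mask of a Boolean predicate restricted to `[0, I)` -/
def maskGo (P : ℕ → Bool) : ℕ → ℕ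
  | 0 => 0
  | i + 1 => maskGo P i ||| (if P i then 2 ^ i else 0)

/-- bits of the mask of a predicate -/
theorem testBit_maskGo (P : ℕ → Bool) : ∀ I j, (maskGo P I).testBit j = (decide (j < I) && P j) := by
  intro I
  induction I with
  | zero => simp [maskGo]
  | succ I ih =>
    intro j
    rw [maskGo, Nat.testBit_or, ih]
    by_cases hP : P I = true
    · rw [if_pos hP, Nat.testBit_two_pow]
      by_cases hjI : j = I
      · subst hjI; simp [hP]
      · have : decide (I = j) = false := decide_eq_false (Ne.symm hjI)
        rw [this, Bool.or_false]
        by_cases hj : j < I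
        · simp [hj, Nat.lt_succ_of_lt hj]
        · have : ¬ j < I + 1 := by omega
          simp [hj, this]
    · rw [if_neg hP, Nat.zero_testBit, Bool.or_false]
      by_cases hjI : j = I
      · subst hjI; simp [hP]
      · by_cases hj : j < I
        · simp [hj, Nat.lt_succ_of_lt hj]
        · have : ¬ j < I + 1 := by omega
          simp [hj, this]

/-- bits of a dilated mask -/
theorem testBit_dilGo (p η A : ℕ) :
    ∀ I j, (dilGo p η A I).testBit j = true ↔ ∃ i < I, A.testBit i = true ∧ η * i % p = j := by
  intro I
  induction I with
  | zero => simp [dilGo]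
  | succ I ih =>
    intro j
    rw [dilGo, Nat.testBit_or, Bool.or_eq_true, ih]
    constructor
    · rintro (⟨i, hi, hA, hj⟩ | h)
      · exact ⟨i, by omega, hA, hj⟩
      · by_cases hA : A.testBit I = true
        · rw [if_pos hA, Nat.testBit_two_pow, decide_eq_true_eq] at h
          exact ⟨I, by omega, hA, h⟩
        · rw [if_neg hA, Nat.zero_testBit] at h
          exact absurd h Bool.false_ne_true
    · rintro ⟨i, hi, hA, hj⟩
      rcases Nat.lt_succ_iff_lt_or_eq.1 hi with hi | rfl
      · exact Or.inl ⟨i, hi, hA, hj⟩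
      · right
        rw [if_pos hA, Nat.testBit_two_pow, decide_eq_true_eq]
        exact hj

/-- bits of a dilated mask -/
theorem testBit_dil {p η A j : ℕ} :
    (dil p η A).testBit j = true ↔ ∃ i < p, A.testBit i = true ∧ η * i % p = j :=
  testBit_dilGo p η A p j

/-- re-association under `% p` -/
theorem mul_mod_assoc (a b c p : ℕ) : a * (b * c % p) % p = a * b % p * c % p := by
  have h1 : a * (b * c % p) % p = a * (b * c) % p := by
    rw [Nat.mul_mod, Nat.mod_mod, ← Nat.mul_mod]
  have h2 : a * b % p * c % p = a * b * c % p := by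
    rw [Nat.mul_mod, Nat.mod_mod, ← Nat.mul_mod]
  rw [h1, h2, mul_assoc]

/-- dilations compose through the product of the multipliers -/
theorem dil_dil {p : ℕ} (hp : 0 < p) (η η' A : ℕ) :
    dil p η' (dil p η A) = dil p (η' * η % p) A := by
  apply Nat.eq_of_testBit_eq
  intro j
  apply Bool.eq_iff_iff.2
  rw [testBit_dil, testBit_dil]
  constructor
  · rintro ⟨i, hi, hbit, hj⟩
    obtain ⟨i', hi', hA, hi'eq⟩ := testBit_dil.1 hbit
    refine ⟨i', hi', hA, ?_⟩
    rw [← hj, ← hi'eq, mul_mod_assoc]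
  · rintro ⟨i', hi', hA, hj⟩
    refine ⟨η * i' % p, Nat.mod_lt _ hp, testBit_dil.2 ⟨i', hi', hA, rfl⟩, ?_⟩
    rw [← hj, mul_mod_assoc]

section Defs

variable {p : ℕ}

/-- parabola-freeness of `T ⊆ ℤ_p × ℤ_p` in the planner's hypothesis shape: no two points
`(x, c), (x', c')` with `x ≠ x'` and `c - c' = (x' - x)²` (both signs follow by symmetry) -/
def PF (T : Finset (ZMod p × ZMod p)) : Prop :=
  ∀ t ∈ T, ∀ t' ∈ T, (t'.1 - t.1) ^ 2 = t.2 - t'.2 → t'.1 = t.1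

/-- the column-`x` mask of `T`: bit `j < p` is set iff `((x : ZMod p), (j : ZMod p)) ∈ T` -/
def colMask (T : Finset (ZMod p × ZMod p)) (x : ℕ) : ℕ :=
  maskGo (fun j => decide ((((x : ℕ) : ZMod p), ((j : ℕ) : ZMod p)) ∈ T)) p

/-- the number of points of `T` in the column `a` -/
def ccZ (T : Finset (ZMod p × ZMod p)) (a : ZMod p) : ℕ := (T.filter fun t => t.1 = a).card

/-- the dilation `(x, c) ↦ (u x, η c)` -/
def dilate (u η : ZMod p) (t : ZMod p × ZMod p) : ZMod p × ZMod p := (u * t.1, η * t.2)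

/-- bits of a column mask -/
theorem testBit_colMask (T : Finset (ZMod p × ZMod p)) (x j : ℕ) :
    (colMask T x).testBit j = true ↔ j < p ∧ (((x : ℕ) : ZMod p), ((j : ℕ) : ZMod p)) ∈ T := by
  simp [colMask, testBit_maskGo]

/-- a column mask is a `p`-bit mask -/
theorem colMask_lt (T : Finset (ZMod p × ZMod p)) (x : ℕ) : colMask T x < 2 ^ p :=
  Nat.lt_pow_two_of_testBit _ fun i hi => by
    rw [Bool.eq_false_iff, Ne, testBit_colMask]
    exact fun h => absurd h.1 (by omega)

end Defs

variable {p : ℕ} [hp : Fact p.Prime]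

/-- the shift `sOf p x y` is `(y - x)²` in `ZMod p` -/
theorem cast_sOf {x y : ℕ} (hx : x < p) :
    ((sOf p x y : ℕ) : ZMod p) = ((y : ZMod p) - (x : ZMod p)) ^ 2 := by
  rw [sOf, ZMod.natCast_mod, Nat.cast_pow, ZMod.natCast_mod, Nat.cast_sub (by omega),
    Nat.cast_add, ZMod.natCast_self, add_zero]

/-- **Adjacency transfer.**  In a parabola-free set, points `(x, i)`, `(y, j)` in different
columns have `j ∉ {i + (y-x)², i - (y-x)²}`: the two residues that the packed neighbourhood
`nb p x i` marks in lane `y`. -/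
theorem not_adj_of_PF {T : Finset (ZMod p × ZMod p)} (hT : PF T) {x y i j : ℕ} (hx : x < p)
    (hy : y < p) (hxy : x ≠ y) (hi : ((x : ZMod p), (i : ZMod p)) ∈ T)
    (hjT : ((y : ZMod p), (j : ZMod p)) ∈ T) :
    j ≠ (i + sOf p x y) % p ∧ j ≠ (i + p - sOf p x y) % p := by
  have hp0 : 0 < p := hp.out.pos
  have hs : sOf p x y < p := sOf_lt hp0 x y
  constructor
  · intro hjeq
    have hcast : (j : ZMod p) = (i : ZMod p) + ((y : ZMod p) - x) ^ 2 := by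
      rw [hjeq, ZMod.natCast_mod, Nat.cast_add, cast_sOf hx]
    -- PF with t = (y, j), t' = (x, i)
    have := hT _ hjT _ hi (by simp only; rw [hcast]; ring)
    exact hxy (FlagLine.nat_eq_of_cast_eq hx hy this)
  · intro hjeq
    have hcast : (j : ZMod p) = (i : ZMod p) - ((y : ZMod p) - x) ^ 2 := by
      rw [hjeq, ZMod.natCast_mod, Nat.cast_sub (by omega), Nat.cast_add, ZMod.natCast_self,
        add_zero, cast_sOf hx]
    -- PF with t = (x, i), t' = (y, j)
    have := hT _ hi _ hjT (by simp only; rw [hcast]; ring)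
    exact hxy (FlagLine.nat_eq_of_cast_eq hy hx this).symm

/-- the packed neighbourhood bit is off between two points of a parabola-free set in different
columns -/
theorem nb_testBit_false_of_PF (hp16 : p ≤ 16) {T : Finset (ZMod p × ZMod p)} (hT : PF T)
    {x y i j : ℕ} (hx : x < p) (hy : y < p) (hxy : x ≠ y)
    (hi : (colMask T x).testBit i = true) (hjb : (colMask T y).testBit j = true) :
    (nb p x i).testBit (16 * y + j) = false := by
  have hp0 : 0 < p := hp.out.pos
  obtain ⟨_, hi⟩ := (testBit_colMask T x i).1 hi
  obtain ⟨hj, hjT⟩ := (testBit_colMask T y j).1 hjb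
  rw [Bool.eq_false_iff, Ne, testBit_nb hp0 hp16 x i hy (hj.trans_le hp16)]
  rintro ⟨-, h⟩
  obtain ⟨h1, h2⟩ := not_adj_of_PF hT hx hy hxy hi hjT
  exact h.elim h1 h2

/-! ## Counting by columns -/

omit hp in
/-- the number of set bits is a filtered-range cardinality -/
theorem length_bitsOf_eq_card (p a : ℕ) :
    (bitsOf p a).length = ((Finset.range p).filter fun i => a.testBit i = true).card := by
  rw [bitsOf, ← List.toFinset_card_of_nodup ((List.nodup_range).filter _), List.toFinset_filter,
    List.toFinset_range]

/-- the column count in `ZMod p` equals the popcount of the column mask -/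
theorem ccZ_eq_length (T : Finset (ZMod p × ZMod p)) (x : ℕ) :
    ccZ T (x : ZMod p) = (bitsOf p (colMask T x)).length := by
  rw [length_bitsOf_eq_card, ccZ]
  refine Finset.card_bij' (fun t _ => t.2.val) (fun j _ => ((x : ZMod p), (j : ZMod p))) ?_ ?_ ?_ ?_
  · intro t ht
    rw [Finset.mem_filter] at ht ⊢
    refine ⟨Finset.mem_range.2 (ZMod.val_lt _), ?_⟩
    rw [testBit_colMask]
    refine ⟨ZMod.val_lt _, ?_⟩
    rw [ZMod.natCast_zmod_val, ← ht.2]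
    exact ht.1
  · intro j hj
    rw [Finset.mem_filter, Finset.mem_range, testBit_colMask] at hj
    rw [Finset.mem_filter]
    exact ⟨hj.2.2, rfl⟩
  · intro t ht
    rw [Finset.mem_filter] at ht
    ext
    · exact ht.2.symm
    · exact ZMod.natCast_zmod_val _
  · intro j hj
    rw [Finset.mem_filter, Finset.mem_range] at hj
    simp only
    rw [ZMod.val_natCast, Nat.mod_eq_of_lt hj.1]

/-- `|T|` is the sum of its column counts -/
theorem card_eq_sum_cols (T : Finset (ZMod p × ZMod p)) :
    T.card = ∑ x ∈ Finset.range p, (bitsOf p (colMask T x)).length := by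
  rw [Finset.card_eq_sum_card_fiberwise (f := fun t : ZMod p × ZMod p => t.1.val)
    (t := Finset.range p) fun t _ => Finset.mem_range.2 (ZMod.val_lt _)]
  refine Finset.sum_congr rfl fun x hx => ?_
  rw [Finset.mem_range] at hx
  rw [← ccZ_eq_length T x, ccZ]
  congr 1
  ext t
  simp only [Finset.mem_filter, and_congr_right_iff]
  intro _
  constructor
  · intro h; rw [← h, ZMod.natCast_zmod_val]
  · intro h; rw [h, ZMod.val_natCast, Nat.mod_eq_of_lt hx]

/-- `|T|` split as column 0 plus the columns `1 … p-1` -/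
theorem card_eq_col_zero_add (T : Finset (ZMod p × ZMod p)) :
    T.card = (bitsOf p (colMask T 0)).length +
      ((cols₀ p).map fun y => (bitsOf p (colMask T y)).length).sum := by
  have hp1 : Finset.range p = Finset.range ((p - 1) + 1) := by
    rw [Nat.sub_add_cancel hp.out.one_lt.le]
  rw [card_eq_sum_cols, hp1, Finset.sum_range_succ', add_comm, cols₀, List.map_map,
    ← List.toFinset_range, List.sum_toFinset _ List.nodup_range]
  rfl

end Summit.MatrixMultiplication.MatrixMultiplication.Theorems.LevelOneGL2Designs.PFS
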